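import Summits.CriticalPhenomena.PercolationContinuityZ3.Theorems.PercNearOneGluingNoHeavyLowerTailKnThm2BridgedAux
import HarnessLib

/-! # Crux `PercNearOneGluing.NoHeavyLowerTail` (stmt-CriticalPhenomena-4575) / `AdditiveGluing` (4576), three relays —
# the BRIDGED refined Kozma–Nitzan exchange: the six BHK steps of `knThm2_refined` with the plus-events split along
# "`b` is joined to the source set already in `G − o`" (depth prover `nh-dp-commonrelay`, gen 4)

Support file (`--supports stmt-CriticalPhenomena-4575`); no definitions, no named facts, no sorries.

Setting of Kozma–Nitzan's Theorem 2 (arXiv:2401.12397, pp. 8–9): relays `a₁, a₂, a₃` (designated `a₃`), observer `o`, target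
`b`, `X := μ(o↔A, o↔b) − μ(o↔A, a₃↔b) = I + II + III` (`stub_knThm2GoodSplit`), refined conditioning events
`N'₁₂ = {a₁,a₂,o ↮ a₃}`, `N'₁ = {a₁,o ↮ a₂,a₃}`, `N'₂` (seat (d)'s `knThm2_refined`: source sets `O ∪ {o}`).  Write `H = G − o`
(all pairs at `o` closed: the configuration `ω ∖ {e | o ∈ e}`), `T_O = ⋂_{s∈O} {s ↔ b}` and `H_O = ⋂_{s∈O} {s ↔ b in H} ⊆ T_O`.
On `T_O ∖ H_O` some `s ∈ O` reaches `b` only through `o`, so `o ↔ O` holds AUTOMATICALLY (`knBr_bridge`); hence the plus-term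
`μ(N'_O ∩ {o↔O} ∩ T_O)` equals `μ(N'_O ∩ {o↔O} ∩ H_O) + μ(N'_O ∩ (T_O ∖ H_O))`, and BHK 2006 Thm 1.3 (cluster of the SET `O ∪ {o}`,
with the increasing function `1{O ↔ b in H}` of that cluster, `knBr_bhkOne`) is applied to the first part only:
  `P'_O · μ(N'_O ∩ {o↔O} ∩ T_O) ≥ A_O · h_O + P'_O · (m'_O − h_O)`,  `h_O := μ(N'_O ∩ H_O) ≤ m'_O := μ(N'_O ∩ T_O)`,
while the minus terms are bounded exactly as in `knThm2_refined` (`knRef_bhkTwo`).  Result (`knThm2_bridged`): the pre-FKG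
inequality (3) at `a₃` follows from the BRIDGED CERTIFICATE
  `Σ_O  w_O · [A_O (h_O − m'_{A∖O}) + P'_O (m'_O − h_O)] ≥ 0`   (`w₁₂ = P'₁P'₂`, `w₁ = P'₂P'₁₂`, `w₂ = P'₁P'₁₂`),
i.e. in conditional form `X ≥ Θ'' := Σ_O [φ'_O (h_O − m'_{A∖O}) + (m'_O − h_O)] = Θ' + Σ_O (1 − φ'_O)(m'_O − h_O) ≥ Θ'`.
Why it matters (this seat's exact engine + kit census, memo RESIDUAL-gen4.md in run/shared/lean/prim/prim-nh-dp-commonrelay/):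
with `a₃` the `τ`-minimiser, `Θ'' ≥ 0` held on every instance examined (random, full-tie, gen-3 corners, adversarial climbs),
including the joint failures of the refined chain `Θ'` and of the one-step BHK(O,b) certificate, and `Θ'' = X` EXACTLY when
`o` is adjacent only to relays (KN Theorem 4's stratum) — the first three-relay certificate with no known failure.
Corollaries: unconditional form (`knThm2_bridged'`, via the landed `stub_bhkSets`) and the additive E-form.
[cite: KozmaNitzan2024, Theorem 2 (§3.1, pp. 8–9), Theorem 4 / Lemma 5 (§3.2, pp. 12–14); VandenbergHaggstromKahn2005, Thms. 1.3–1.4]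
-/

namespace Summit.CriticalPhenomena.PercolationContinuityZ3.Theorems

open MeasureTheory Set Literature.Probability.LatticeModels Literature.Probability.Percolation

noncomputable section
open Classical

variable {n : ℕ}

/-- **The bridged refined Kozma–Nitzan exchange at a designation** (`a₃` any designated relay, no minimality; `o` not a relay).
Notation: `N'₁₂ = {a₁↮a₃} ∩ {a₂↮a₃} ∩ {o↮a₃}`, `N'₁ = {a₁↮a₂} ∩ {a₁↮a₃} ∩ {o↮a₂} ∩ {o↮a₃}`, `N'₂` symmetric, `P'_O = μ(N'_O)`,
`A₁₂ = μ(N'₁₂ ∩ {A₁₂↔o})`, `A₁ = μ(N'₁ ∩ {a₁↔o})`, `A₂`, `m'_T = μ(N'_O ∩ {b ↔ all of T})`, and the NEW H-masses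
`h₁₂ = μ(N'₁₂ ∩ {a₁ ↔ b in H} ∩ {a₂ ↔ b in H})`, `h₁ = μ(N'₁ ∩ {a₁ ↔ b in H})`, `h₂ = μ(N'₂ ∩ {a₂ ↔ b in H})`, where
"`x ↔ b in H`" is connection in the configuration with all pairs at `o` removed.  If
`P'₁P'₂·[A₁₂(h₁₂ − m'₃) + P'₁₂(m'₁₂ − h₁₂)] + P'₂P'₁₂·[A₁(h₁ − m'₂₃) + P'₁(m'₁ − h₁)] + P'₁P'₁₂·[A₂(h₂ − m''₁₃) + P'₂(m''₂ − h₂)] ≥ 0`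
then `μ(o↔A, a₃↔b) ≤ μ(o↔A, o↔b)` (pre-FKG (3) at `a₃`).  Proof: `X = I + II + III` (`stub_knThm2GoodSplit`), each plus-term split
along the bridge (`knBr_plus_split`), BHK Thm 1.3 with `1{O ↔ b in H}` (`knBr_bhkOne`) for the H-part, BHK Thm 1.4 for the
minus-terms (`knRef_bhkTwo`), and `knBr_arith`.  Since `h_O ≤ m'_O` and `A_O ≤ P'_O`, the hypothesis is WEAKER than that of
`knThm2_refined` (bridged certificate `Θ'' = Θ' + Σ_O (1 − φ'_O)(m'_O − h_O) ≥ Θ'`).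
[cite: KozmaNitzan2024, Theorem 2 (§3.1, pp. 8–9), Lemma 5 (p. 13); VandenbergHaggstromKahn2005, Thms. 1.3–1.4] -/
theorem knThm2_bridged
    (hB1 : ∀ (n : ℕ) (w : Sym2 (Fin n) → unitInterval) (S : Finset (Fin n)) (X : Set (Fin n))
        (F G : Set (Sym2 (Fin n)) → ℝ), Monotone F → Monotone G → (∀ s ∈ S, s ∉ X) →
        (∫ ω in {ω : BondConfig (Fin n) | ∀ s ∈ S, ∀ x ∈ X, ¬ (openGraph ω).Reachable s x},
            F (⋃ s ∈ S, openEdgeCluster ω s) ∂(prodBernoulli w)) *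
          (∫ ω in {ω : BondConfig (Fin n) | ∀ s ∈ S, ∀ x ∈ X, ¬ (openGraph ω).Reachable s x},
            G (⋃ s ∈ S, openEdgeCluster ω s) ∂(prodBernoulli w)) ≤
        (prodBernoulli w).real
            {ω : BondConfig (Fin n) | ∀ s ∈ S, ∀ x ∈ X, ¬ (openGraph ω).Reachable s x} *
          ∫ ω in {ω : BondConfig (Fin n) | ∀ s ∈ S, ∀ x ∈ X, ¬ (openGraph ω).Reachable s x},
            F (⋃ s ∈ S, openEdgeCluster ω s) * G (⋃ s ∈ S, openEdgeCluster ω s)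
              ∂(prodBernoulli w))
    (hB2 : ∀ (n : ℕ) (w : Sym2 (Fin n) → unitInterval) (S S' : Finset (Fin n))
        (F G : Set (Sym2 (Fin n)) → ℝ), Monotone F → Monotone G → Disjoint S S' →
        (prodBernoulli w).real
            {ω : BondConfig (Fin n) | ∀ s ∈ S, ∀ x ∈ S', ¬ (openGraph ω).Reachable s x} *
          (∫ ω in {ω : BondConfig (Fin n) | ∀ s ∈ S, ∀ x ∈ S', ¬ (openGraph ω).Reachable s x},
            F (⋃ s ∈ S, openEdgeCluster ω s) * G (⋃ s ∈ S', openEdgeCluster ω s)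
              ∂(prodBernoulli w)) ≤
        (∫ ω in {ω : BondConfig (Fin n) | ∀ s ∈ S, ∀ x ∈ S', ¬ (openGraph ω).Reachable s x},
            F (⋃ s ∈ S, openEdgeCluster ω s) ∂(prodBernoulli w)) *
          (∫ ω in {ω : BondConfig (Fin n) | ∀ s ∈ S, ∀ x ∈ S', ¬ (openGraph ω).Reachable s x},
            G (⋃ s ∈ S', openEdgeCluster ω s) ∂(prodBernoulli w)))
    (w : Sym2 (Fin n) → unitInterval) (o b a₁ a₂ a₃ : Fin n)
    (h12 : a₁ ≠ a₂) (h13 : a₁ ≠ a₃) (h23 : a₂ ≠ a₃) (ho1 : o ≠ a₁) (ho2 : o ≠ a₂) (ho3 : o ≠ a₃)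
    (hP₁₂ : 0 < (prodBernoulli w).real ((openConn a₁ a₃)ᶜ ∩ (openConn a₂ a₃)ᶜ ∩ (openConn o a₃)ᶜ : Set (BondConfig (Fin n))))
    (hP₁ : 0 < (prodBernoulli w).real ((openConn a₁ a₂)ᶜ ∩ (openConn a₁ a₃)ᶜ ∩ ((openConn o a₂)ᶜ ∩ (openConn o a₃)ᶜ) : Set (BondConfig (Fin n))))
    (hP₂ : 0 < (prodBernoulli w).real ((openConn a₂ a₁)ᶜ ∩ (openConn a₂ a₃)ᶜ ∩ ((openConn o a₁)ᶜ ∩ (openConn o a₃)ᶜ) : Set (BondConfig (Fin n))))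
    (hcert : 0 ≤
        (prodBernoulli w).real ((openConn a₁ a₂)ᶜ ∩ (openConn a₁ a₃)ᶜ ∩ ((openConn o a₂)ᶜ ∩ (openConn o a₃)ᶜ) : Set (BondConfig (Fin n)))
          * (prodBernoulli w).real ((openConn a₂ a₁)ᶜ ∩ (openConn a₂ a₃)ᶜ ∩ ((openConn o a₁)ᶜ ∩ (openConn o a₃)ᶜ) : Set (BondConfig (Fin n)))
          * ((prodBernoulli w).real ((openConn a₁ a₃)ᶜ ∩ (openConn a₂ a₃)ᶜ ∩ (openConn o a₃)ᶜ ∩ (openConn a₁ o ∪ openConn a₂ o)) * ((prodBernoulli w).real ((openConn a₁ a₃)ᶜ ∩ (openConn a₂ a₃)ᶜ ∩ (openConn o a₃)ᶜ ∩ ({ω' : BondConfig (Fin n) | (openGraph (ω' \ {e | o ∈ e})).Reachable a₁ b} ∩ {ω' : BondConfig (Fin n) | (openGraph (ω' \ {e | o ∈ e})).Reachable a₂ b}))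
                - (prodBernoulli w).real ((openConn a₁ a₃)ᶜ ∩ (openConn a₂ a₃)ᶜ ∩ (openConn o a₃)ᶜ ∩ openConn a₃ b))
             + (prodBernoulli w).real ((openConn a₁ a₃)ᶜ ∩ (openConn a₂ a₃)ᶜ ∩ (openConn o a₃)ᶜ : Set (BondConfig (Fin n))) * ((prodBernoulli w).real ((openConn a₁ a₃)ᶜ ∩ (openConn a₂ a₃)ᶜ ∩ (openConn o a₃)ᶜ ∩ (openConn a₁ b ∩ openConn a₂ b))
                - (prodBernoulli w).real ((openConn a₁ a₃)ᶜ ∩ (openConn a₂ a₃)ᶜ ∩ (openConn o a₃)ᶜ ∩ ({ω' : BondConfig (Fin n) | (openGraph (ω' \ {e | o ∈ e})).Reachable a₁ b} ∩ {ω' : BondConfig (Fin n) | (openGraph (ω' \ {e | o ∈ e})).Reachable a₂ b}))))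
      + (prodBernoulli w).real ((openConn a₂ a₁)ᶜ ∩ (openConn a₂ a₃)ᶜ ∩ ((openConn o a₁)ᶜ ∩ (openConn o a₃)ᶜ) : Set (BondConfig (Fin n)))
          * (prodBernoulli w).real ((openConn a₁ a₃)ᶜ ∩ (openConn a₂ a₃)ᶜ ∩ (openConn o a₃)ᶜ : Set (BondConfig (Fin n)))
          * ((prodBernoulli w).real ((openConn a₁ a₂)ᶜ ∩ (openConn a₁ a₃)ᶜ ∩ ((openConn o a₂)ᶜ ∩ (openConn o a₃)ᶜ) ∩ openConn a₁ o) * ((prodBernoulli w).real ((openConn a₁ a₂)ᶜ ∩ (openConn a₁ a₃)ᶜ ∩ ((openConn o a₂)ᶜ ∩ (openConn o a₃)ᶜ) ∩ {ω' : BondConfig (Fin n) | (openGraph (ω' \ {e | o ∈ e})).Reachable a₁ b})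
                - (prodBernoulli w).real ((openConn a₁ a₂)ᶜ ∩ (openConn a₁ a₃)ᶜ ∩ ((openConn o a₂)ᶜ ∩ (openConn o a₃)ᶜ) ∩ (openConn a₂ b ∩ openConn a₃ b)))
             + (prodBernoulli w).real ((openConn a₁ a₂)ᶜ ∩ (openConn a₁ a₃)ᶜ ∩ ((openConn o a₂)ᶜ ∩ (openConn o a₃)ᶜ) : Set (BondConfig (Fin n))) * ((prodBernoulli w).real ((openConn a₁ a₂)ᶜ ∩ (openConn a₁ a₃)ᶜ ∩ ((openConn o a₂)ᶜ ∩ (openConn o a₃)ᶜ) ∩ openConn a₁ b)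
                - (prodBernoulli w).real ((openConn a₁ a₂)ᶜ ∩ (openConn a₁ a₃)ᶜ ∩ ((openConn o a₂)ᶜ ∩ (openConn o a₃)ᶜ) ∩ {ω' : BondConfig (Fin n) | (openGraph (ω' \ {e | o ∈ e})).Reachable a₁ b})))
      + (prodBernoulli w).real ((openConn a₁ a₂)ᶜ ∩ (openConn a₁ a₃)ᶜ ∩ ((openConn o a₂)ᶜ ∩ (openConn o a₃)ᶜ) : Set (BondConfig (Fin n)))
          * (prodBernoulli w).real ((openConn a₁ a₃)ᶜ ∩ (openConn a₂ a₃)ᶜ ∩ (openConn o a₃)ᶜ : Set (BondConfig (Fin n)))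
          * ((prodBernoulli w).real ((openConn a₂ a₁)ᶜ ∩ (openConn a₂ a₃)ᶜ ∩ ((openConn o a₁)ᶜ ∩ (openConn o a₃)ᶜ) ∩ openConn a₂ o) * ((prodBernoulli w).real ((openConn a₂ a₁)ᶜ ∩ (openConn a₂ a₃)ᶜ ∩ ((openConn o a₁)ᶜ ∩ (openConn o a₃)ᶜ) ∩ {ω' : BondConfig (Fin n) | (openGraph (ω' \ {e | o ∈ e})).Reachable a₂ b})
                - (prodBernoulli w).real ((openConn a₂ a₁)ᶜ ∩ (openConn a₂ a₃)ᶜ ∩ ((openConn o a₁)ᶜ ∩ (openConn o a₃)ᶜ) ∩ (openConn a₁ b ∩ openConn a₃ b)))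
             + (prodBernoulli w).real ((openConn a₂ a₁)ᶜ ∩ (openConn a₂ a₃)ᶜ ∩ ((openConn o a₁)ᶜ ∩ (openConn o a₃)ᶜ) : Set (BondConfig (Fin n))) * ((prodBernoulli w).real ((openConn a₂ a₁)ᶜ ∩ (openConn a₂ a₃)ᶜ ∩ ((openConn o a₁)ᶜ ∩ (openConn o a₃)ᶜ) ∩ openConn a₂ b)
                - (prodBernoulli w).real ((openConn a₂ a₁)ᶜ ∩ (openConn a₂ a₃)ᶜ ∩ ((openConn o a₁)ᶜ ∩ (openConn o a₃)ᶜ) ∩ {ω' : BondConfig (Fin n) | (openGraph (ω' \ {e | o ∈ e})).Reachable a₂ b})))) :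
    (prodBernoulli w).real ((openConn o a₁ ∪ openConn o a₂ ∪ openConn o a₃) ∩ openConn a₃ b) ≤
      (prodBernoulli w).real ((openConn o a₁ ∪ openConn o a₂ ∪ openConn o a₃) ∩ openConn o b) := by
  -- the three bridged plus-bounds and the three minus-bounds
  have hs12 : ({a₁, a₂} : Finset (Fin n)) ⊆ {a₁, a₂, o} := by
    intro x hx; simp only [Finset.mem_insert, Finset.mem_singleton] at hx ⊢; tauto
  have hs1 : ({a₁} : Finset (Fin n)) ⊆ {a₁, o} := by
    intro x hx; simp only [Finset.mem_insert, Finset.mem_singleton] at hx ⊢; tauto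
  have hs2 : ({a₂} : Finset (Fin n)) ⊆ {a₂, o} := by
    intro x hx; simp only [Finset.mem_insert, Finset.mem_singleton] at hx ⊢; tauto
  have i1 := knBr_bhkOne hB1 w {a₁, a₂, o} {a₁, a₂} hs12 ({a₃} : Set (Fin n)) o b
    (by simp [h13, h23, ho3])
  have i2 := knRef_bhkTwo hB2 w {a₁, a₂, o} {a₃} {a₁, a₂} {a₃} hs12 subset_rfl o b
    (by simp [h13.symm, h23.symm, ho3.symm])
  have i3 := knBr_bhkOne hB1 w {a₁, o} {a₁} hs1 ({a₂, a₃} : Set (Fin n)) o b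
    (by simp [h12, h13, ho2, ho3])
  have i4 := knRef_bhkTwo hB2 w {a₁, o} {a₂, a₃} {a₁} {a₂, a₃} hs1 subset_rfl o b
    (by simp [h12.symm, h13.symm, ho2.symm, ho3.symm])
  have i5 := knBr_bhkOne hB1 w {a₂, o} {a₂} hs2 ({a₁, a₃} : Set (Fin n)) o b
    (by simp [h12.symm, h23, ho1, ho3])
  have i6 := knRef_bhkTwo hB2 w {a₂, o} {a₁, a₃} {a₂} {a₁, a₃} hs2 subset_rfl o b
    (by simp [h12, h23.symm, ho1.symm, ho3.symm])
  rw [knRef_sep3_set, Finset.set_biUnion_insert, Finset.set_biUnion_singleton,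
    Finset.set_biInter_insert, Finset.set_biInter_singleton] at i1
  rw [knRef_sep3_finset, Finset.set_biUnion_insert, Finset.set_biUnion_singleton,
    Finset.set_biInter_singleton] at i2
  rw [knRef_sep2_set, Finset.set_biUnion_singleton, Finset.set_biInter_singleton] at i3
  rw [knRef_sep2_finset, Finset.set_biUnion_singleton, Finset.set_biInter_insert,
    Finset.set_biInter_singleton] at i4
  rw [knRef_sep2_set, Finset.set_biUnion_singleton, Finset.set_biInter_singleton] at i5
  rw [knRef_sep2_finset, Finset.set_biUnion_singleton, Finset.set_biInter_insert,
    Finset.set_biInter_singleton] at i6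
  -- the bridge splits of the three plus-terms
  have s1 := knBr_plus_split w ((openConn a₁ a₃)ᶜ ∩ (openConn a₂ a₃)ᶜ ∩ (openConn o a₃)ᶜ : Set (BondConfig (Fin n))) {a₁, a₂} o b
  have s3 := knBr_plus_split w ((openConn a₁ a₂)ᶜ ∩ (openConn a₁ a₃)ᶜ ∩ ((openConn o a₂)ᶜ ∩ (openConn o a₃)ᶜ) : Set (BondConfig (Fin n))) {a₁} o b
  have s5 := knBr_plus_split w ((openConn a₂ a₁)ᶜ ∩ (openConn a₂ a₃)ᶜ ∩ ((openConn o a₁)ᶜ ∩ (openConn o a₃)ᶜ) : Set (BondConfig (Fin n))) {a₂} o b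
  rw [Finset.set_biUnion_insert, Finset.set_biUnion_singleton, Finset.set_biInter_insert, Finset.set_biInter_singleton,
    Finset.set_biInter_insert, Finset.set_biInter_singleton] at s1
  rw [Finset.set_biUnion_singleton, Finset.set_biInter_singleton, Finset.set_biInter_singleton] at s3
  rw [Finset.set_biUnion_singleton, Finset.set_biInter_singleton, Finset.set_biInter_singleton] at s5
  -- `X = I + II + III`, rewritten on the refined conditioning events
  have hsplit := stub_knThm2GoodSplit n w o b a₁ a₂ a₃
  rw [knRef_absorb12 o a₁ a₂ a₃ (openConn a₁ b ∩ openConn a₂ b), knRef_absorb12 o a₁ a₂ a₃ (openConn a₃ b),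
    knRef_absorb1 o a₁ a₂ a₃ (openConn a₁ b), knRef_absorb1 o a₁ a₂ a₃ (openConn a₂ b ∩ openConn a₃ b),
    knRef_absorb1 o a₂ a₁ a₃ (openConn a₂ b), knRef_absorb1 o a₂ a₁ a₃ (openConn a₁ b ∩ openConn a₃ b)] at hsplit
  have key := knBr_arith hP₁₂ hP₁ hP₂ i1 s1 i2 i3 s3 i4 i5 s5 i6 hcert
  linarith

/-- **Unconditional form of the bridged exchange**: the set-BHK tools are the landed `stub_bhkSets`.
[cite: KozmaNitzan2024, Theorem 2 (§3.1, pp. 8–9); VandenbergHaggstromKahn2005, Thms. 1.3–1.4] -/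
theorem knThm2_bridged'
    (w : Sym2 (Fin n) → unitInterval) (o b a₁ a₂ a₃ : Fin n)
    (h12 : a₁ ≠ a₂) (h13 : a₁ ≠ a₃) (h23 : a₂ ≠ a₃) (ho1 : o ≠ a₁) (ho2 : o ≠ a₂) (ho3 : o ≠ a₃)
    (hP₁₂ : 0 < (prodBernoulli w).real ((openConn a₁ a₃)ᶜ ∩ (openConn a₂ a₃)ᶜ ∩ (openConn o a₃)ᶜ : Set (BondConfig (Fin n))))
    (hP₁ : 0 < (prodBernoulli w).real ((openConn a₁ a₂)ᶜ ∩ (openConn a₁ a₃)ᶜ ∩ ((openConn o a₂)ᶜ ∩ (openConn o a₃)ᶜ) : Set (BondConfig (Fin n))))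
    (hP₂ : 0 < (prodBernoulli w).real ((openConn a₂ a₁)ᶜ ∩ (openConn a₂ a₃)ᶜ ∩ ((openConn o a₁)ᶜ ∩ (openConn o a₃)ᶜ) : Set (BondConfig (Fin n))))
    (hcert : 0 ≤
        (prodBernoulli w).real ((openConn a₁ a₂)ᶜ ∩ (openConn a₁ a₃)ᶜ ∩ ((openConn o a₂)ᶜ ∩ (openConn o a₃)ᶜ) : Set (BondConfig (Fin n)))
          * (prodBernoulli w).real ((openConn a₂ a₁)ᶜ ∩ (openConn a₂ a₃)ᶜ ∩ ((openConn o a₁)ᶜ ∩ (openConn o a₃)ᶜ) : Set (BondConfig (Fin n)))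
          * ((prodBernoulli w).real ((openConn a₁ a₃)ᶜ ∩ (openConn a₂ a₃)ᶜ ∩ (openConn o a₃)ᶜ ∩ (openConn a₁ o ∪ openConn a₂ o)) * ((prodBernoulli w).real ((openConn a₁ a₃)ᶜ ∩ (openConn a₂ a₃)ᶜ ∩ (openConn o a₃)ᶜ ∩ ({ω' : BondConfig (Fin n) | (openGraph (ω' \ {e | o ∈ e})).Reachable a₁ b} ∩ {ω' : BondConfig (Fin n) | (openGraph (ω' \ {e | o ∈ e})).Reachable a₂ b}))
                - (prodBernoulli w).real ((openConn a₁ a₃)ᶜ ∩ (openConn a₂ a₃)ᶜ ∩ (openConn o a₃)ᶜ ∩ openConn a₃ b))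
             + (prodBernoulli w).real ((openConn a₁ a₃)ᶜ ∩ (openConn a₂ a₃)ᶜ ∩ (openConn o a₃)ᶜ : Set (BondConfig (Fin n))) * ((prodBernoulli w).real ((openConn a₁ a₃)ᶜ ∩ (openConn a₂ a₃)ᶜ ∩ (openConn o a₃)ᶜ ∩ (openConn a₁ b ∩ openConn a₂ b))
                - (prodBernoulli w).real ((openConn a₁ a₃)ᶜ ∩ (openConn a₂ a₃)ᶜ ∩ (openConn o a₃)ᶜ ∩ ({ω' : BondConfig (Fin n) | (openGraph (ω' \ {e | o ∈ e})).Reachable a₁ b} ∩ {ω' : BondConfig (Fin n) | (openGraph (ω' \ {e | o ∈ e})).Reachable a₂ b}))))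
      + (prodBernoulli w).real ((openConn a₂ a₁)ᶜ ∩ (openConn a₂ a₃)ᶜ ∩ ((openConn o a₁)ᶜ ∩ (openConn o a₃)ᶜ) : Set (BondConfig (Fin n)))
          * (prodBernoulli w).real ((openConn a₁ a₃)ᶜ ∩ (openConn a₂ a₃)ᶜ ∩ (openConn o a₃)ᶜ : Set (BondConfig (Fin n)))
          * ((prodBernoulli w).real ((openConn a₁ a₂)ᶜ ∩ (openConn a₁ a₃)ᶜ ∩ ((openConn o a₂)ᶜ ∩ (openConn o a₃)ᶜ) ∩ openConn a₁ o) * ((prodBernoulli w).real ((openConn a₁ a₂)ᶜ ∩ (openConn a₁ a₃)ᶜ ∩ ((openConn o a₂)ᶜ ∩ (openConn o a₃)ᶜ) ∩ {ω' : BondConfig (Fin n) | (openGraph (ω' \ {e | o ∈ e})).Reachable a₁ b})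
                - (prodBernoulli w).real ((openConn a₁ a₂)ᶜ ∩ (openConn a₁ a₃)ᶜ ∩ ((openConn o a₂)ᶜ ∩ (openConn o a₃)ᶜ) ∩ (openConn a₂ b ∩ openConn a₃ b)))
             + (prodBernoulli w).real ((openConn a₁ a₂)ᶜ ∩ (openConn a₁ a₃)ᶜ ∩ ((openConn o a₂)ᶜ ∩ (openConn o a₃)ᶜ) : Set (BondConfig (Fin n))) * ((prodBernoulli w).real ((openConn a₁ a₂)ᶜ ∩ (openConn a₁ a₃)ᶜ ∩ ((openConn o a₂)ᶜ ∩ (openConn o a₃)ᶜ) ∩ openConn a₁ b)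
                - (prodBernoulli w).real ((openConn a₁ a₂)ᶜ ∩ (openConn a₁ a₃)ᶜ ∩ ((openConn o a₂)ᶜ ∩ (openConn o a₃)ᶜ) ∩ {ω' : BondConfig (Fin n) | (openGraph (ω' \ {e | o ∈ e})).Reachable a₁ b})))
      + (prodBernoulli w).real ((openConn a₁ a₂)ᶜ ∩ (openConn a₁ a₃)ᶜ ∩ ((openConn o a₂)ᶜ ∩ (openConn o a₃)ᶜ) : Set (BondConfig (Fin n)))
          * (prodBernoulli w).real ((openConn a₁ a₃)ᶜ ∩ (openConn a₂ a₃)ᶜ ∩ (openConn o a₃)ᶜ : Set (BondConfig (Fin n)))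
          * ((prodBernoulli w).real ((openConn a₂ a₁)ᶜ ∩ (openConn a₂ a₃)ᶜ ∩ ((openConn o a₁)ᶜ ∩ (openConn o a₃)ᶜ) ∩ openConn a₂ o) * ((prodBernoulli w).real ((openConn a₂ a₁)ᶜ ∩ (openConn a₂ a₃)ᶜ ∩ ((openConn o a₁)ᶜ ∩ (openConn o a₃)ᶜ) ∩ {ω' : BondConfig (Fin n) | (openGraph (ω' \ {e | o ∈ e})).Reachable a₂ b})
                - (prodBernoulli w).real ((openConn a₂ a₁)ᶜ ∩ (openConn a₂ a₃)ᶜ ∩ ((openConn o a₁)ᶜ ∩ (openConn o a₃)ᶜ) ∩ (openConn a₁ b ∩ openConn a₃ b)))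
             + (prodBernoulli w).real ((openConn a₂ a₁)ᶜ ∩ (openConn a₂ a₃)ᶜ ∩ ((openConn o a₁)ᶜ ∩ (openConn o a₃)ᶜ) : Set (BondConfig (Fin n))) * ((prodBernoulli w).real ((openConn a₂ a₁)ᶜ ∩ (openConn a₂ a₃)ᶜ ∩ ((openConn o a₁)ᶜ ∩ (openConn o a₃)ᶜ) ∩ openConn a₂ b)
                - (prodBernoulli w).real ((openConn a₂ a₁)ᶜ ∩ (openConn a₂ a₃)ᶜ ∩ ((openConn o a₁)ᶜ ∩ (openConn o a₃)ᶜ) ∩ {ω' : BondConfig (Fin n) | (openGraph (ω' \ {e | o ∈ e})).Reachable a₂ b})))) :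
    (prodBernoulli w).real ((openConn o a₁ ∪ openConn o a₂ ∪ openConn o a₃) ∩ openConn a₃ b) ≤
      (prodBernoulli w).real ((openConn o a₁ ∪ openConn o a₂ ∪ openConn o a₃) ∩ openConn o b) :=
  knThm2_bridged stub_bhkSets.1 stub_bhkSets.2 w o b a₁ a₂ a₃ h12 h13 h23 ho1 ho2 ho3 hP₁₂ hP₁ hP₂ hcert

/-- **Additive E-form of the bridged exchange**: under the hypotheses of `knThm2_bridged'` and `μ(a₃ ↔ b) ≥ 1 − t`,
`μ({o ↔ A} ∖ {o ↔ b}) ≤ t`. [cite: KozmaNitzan2024, Theorem 2 (§3.1, pp. 8–9)] -/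
theorem knThm2_bridged_eform
    (w : Sym2 (Fin n) → unitInterval) (o b a₁ a₂ a₃ : Fin n)
    (h12 : a₁ ≠ a₂) (h13 : a₁ ≠ a₃) (h23 : a₂ ≠ a₃) (ho1 : o ≠ a₁) (ho2 : o ≠ a₂) (ho3 : o ≠ a₃)
    (hP₁₂ : 0 < (prodBernoulli w).real ((openConn a₁ a₃)ᶜ ∩ (openConn a₂ a₃)ᶜ ∩ (openConn o a₃)ᶜ : Set (BondConfig (Fin n))))
    (hP₁ : 0 < (prodBernoulli w).real ((openConn a₁ a₂)ᶜ ∩ (openConn a₁ a₃)ᶜ ∩ ((openConn o a₂)ᶜ ∩ (openConn o a₃)ᶜ) : Set (BondConfig (Fin n))))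
    (hP₂ : 0 < (prodBernoulli w).real ((openConn a₂ a₁)ᶜ ∩ (openConn a₂ a₃)ᶜ ∩ ((openConn o a₁)ᶜ ∩ (openConn o a₃)ᶜ) : Set (BondConfig (Fin n))))
    (hcert : 0 ≤
        (prodBernoulli w).real ((openConn a₁ a₂)ᶜ ∩ (openConn a₁ a₃)ᶜ ∩ ((openConn o a₂)ᶜ ∩ (openConn o a₃)ᶜ) : Set (BondConfig (Fin n)))
          * (prodBernoulli w).real ((openConn a₂ a₁)ᶜ ∩ (openConn a₂ a₃)ᶜ ∩ ((openConn o a₁)ᶜ ∩ (openConn o a₃)ᶜ) : Set (BondConfig (Fin n)))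
          * ((prodBernoulli w).real ((openConn a₁ a₃)ᶜ ∩ (openConn a₂ a₃)ᶜ ∩ (openConn o a₃)ᶜ ∩ (openConn a₁ o ∪ openConn a₂ o)) * ((prodBernoulli w).real ((openConn a₁ a₃)ᶜ ∩ (openConn a₂ a₃)ᶜ ∩ (openConn o a₃)ᶜ ∩ ({ω' : BondConfig (Fin n) | (openGraph (ω' \ {e | o ∈ e})).Reachable a₁ b} ∩ {ω' : BondConfig (Fin n) | (openGraph (ω' \ {e | o ∈ e})).Reachable a₂ b}))
                - (prodBernoulli w).real ((openConn a₁ a₃)ᶜ ∩ (openConn a₂ a₃)ᶜ ∩ (openConn o a₃)ᶜ ∩ openConn a₃ b))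
             + (prodBernoulli w).real ((openConn a₁ a₃)ᶜ ∩ (openConn a₂ a₃)ᶜ ∩ (openConn o a₃)ᶜ : Set (BondConfig (Fin n))) * ((prodBernoulli w).real ((openConn a₁ a₃)ᶜ ∩ (openConn a₂ a₃)ᶜ ∩ (openConn o a₃)ᶜ ∩ (openConn a₁ b ∩ openConn a₂ b))
                - (prodBernoulli w).real ((openConn a₁ a₃)ᶜ ∩ (openConn a₂ a₃)ᶜ ∩ (openConn o a₃)ᶜ ∩ ({ω' : BondConfig (Fin n) | (openGraph (ω' \ {e | o ∈ e})).Reachable a₁ b} ∩ {ω' : BondConfig (Fin n) | (openGraph (ω' \ {e | o ∈ e})).Reachable a₂ b}))))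
      + (prodBernoulli w).real ((openConn a₂ a₁)ᶜ ∩ (openConn a₂ a₃)ᶜ ∩ ((openConn o a₁)ᶜ ∩ (openConn o a₃)ᶜ) : Set (BondConfig (Fin n)))
          * (prodBernoulli w).real ((openConn a₁ a₃)ᶜ ∩ (openConn a₂ a₃)ᶜ ∩ (openConn o a₃)ᶜ : Set (BondConfig (Fin n)))
          * ((prodBernoulli w).real ((openConn a₁ a₂)ᶜ ∩ (openConn a₁ a₃)ᶜ ∩ ((openConn o a₂)ᶜ ∩ (openConn o a₃)ᶜ) ∩ openConn a₁ o) * ((prodBernoulli w).real ((openConn a₁ a₂)ᶜ ∩ (openConn a₁ a₃)ᶜ ∩ ((openConn o a₂)ᶜ ∩ (openConn o a₃)ᶜ) ∩ {ω' : BondConfig (Fin n) | (openGraph (ω' \ {e | o ∈ e})).Reachable a₁ b})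
                - (prodBernoulli w).real ((openConn a₁ a₂)ᶜ ∩ (openConn a₁ a₃)ᶜ ∩ ((openConn o a₂)ᶜ ∩ (openConn o a₃)ᶜ) ∩ (openConn a₂ b ∩ openConn a₃ b)))
             + (prodBernoulli w).real ((openConn a₁ a₂)ᶜ ∩ (openConn a₁ a₃)ᶜ ∩ ((openConn o a₂)ᶜ ∩ (openConn o a₃)ᶜ) : Set (BondConfig (Fin n))) * ((prodBernoulli w).real ((openConn a₁ a₂)ᶜ ∩ (openConn a₁ a₃)ᶜ ∩ ((openConn o a₂)ᶜ ∩ (openConn o a₃)ᶜ) ∩ openConn a₁ b)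
                - (prodBernoulli w).real ((openConn a₁ a₂)ᶜ ∩ (openConn a₁ a₃)ᶜ ∩ ((openConn o a₂)ᶜ ∩ (openConn o a₃)ᶜ) ∩ {ω' : BondConfig (Fin n) | (openGraph (ω' \ {e | o ∈ e})).Reachable a₁ b})))
      + (prodBernoulli w).real ((openConn a₁ a₂)ᶜ ∩ (openConn a₁ a₃)ᶜ ∩ ((openConn o a₂)ᶜ ∩ (openConn o a₃)ᶜ) : Set (BondConfig (Fin n)))
          * (prodBernoulli w).real ((openConn a₁ a₃)ᶜ ∩ (openConn a₂ a₃)ᶜ ∩ (openConn o a₃)ᶜ : Set (BondConfig (Fin n)))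
          * ((prodBernoulli w).real ((openConn a₂ a₁)ᶜ ∩ (openConn a₂ a₃)ᶜ ∩ ((openConn o a₁)ᶜ ∩ (openConn o a₃)ᶜ) ∩ openConn a₂ o) * ((prodBernoulli w).real ((openConn a₂ a₁)ᶜ ∩ (openConn a₂ a₃)ᶜ ∩ ((openConn o a₁)ᶜ ∩ (openConn o a₃)ᶜ) ∩ {ω' : BondConfig (Fin n) | (openGraph (ω' \ {e | o ∈ e})).Reachable a₂ b})
                - (prodBernoulli w).real ((openConn a₂ a₁)ᶜ ∩ (openConn a₂ a₃)ᶜ ∩ ((openConn o a₁)ᶜ ∩ (openConn o a₃)ᶜ) ∩ (openConn a₁ b ∩ openConn a₃ b)))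
             + (prodBernoulli w).real ((openConn a₂ a₁)ᶜ ∩ (openConn a₂ a₃)ᶜ ∩ ((openConn o a₁)ᶜ ∩ (openConn o a₃)ᶜ) : Set (BondConfig (Fin n))) * ((prodBernoulli w).real ((openConn a₂ a₁)ᶜ ∩ (openConn a₂ a₃)ᶜ ∩ ((openConn o a₁)ᶜ ∩ (openConn o a₃)ᶜ) ∩ openConn a₂ b)
                - (prodBernoulli w).real ((openConn a₂ a₁)ᶜ ∩ (openConn a₂ a₃)ᶜ ∩ ((openConn o a₁)ᶜ ∩ (openConn o a₃)ᶜ) ∩ {ω' : BondConfig (Fin n) | (openGraph (ω' \ {e | o ∈ e})).Reachable a₂ b}))))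
    (t : ℝ) (hτ3 : 1 - t ≤ (prodBernoulli w).real (openConn a₃ b)) :
    (prodBernoulli w).real ((openConn o a₁ ∪ openConn o a₂ ∪ openConn o a₃) \ openConn o b) ≤ t := by
  have hX := knThm2_bridged' w o b a₁ a₂ a₃ h12 h13 h23 ho1 ho2 ho3 hP₁₂ hP₁ hP₂ hcert
  have hm : ∀ s : Set (BondConfig (Fin n)), MeasurableSet s := fun _ => MeasurableSet.of_discrete
  have h1 := measureReal_inter_add_sdiff (μ := prodBernoulli w)
    (s := openConn o a₁ ∪ openConn o a₂ ∪ openConn o a₃) (hm (openConn o b))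
  have h2 := measureReal_inter_add_sdiff (μ := prodBernoulli w)
    (s := openConn o a₁ ∪ openConn o a₂ ∪ openConn o a₃) (hm (openConn a₃ b))
  have h3 : (prodBernoulli w).real
      ((openConn o a₁ ∪ openConn o a₂ ∪ openConn o a₃) \ openConn a₃ b) ≤
      (prodBernoulli w).real ((openConn a₃ b)ᶜ : Set (BondConfig (Fin n))) :=
    measureReal_mono fun ω hω => hω.2
  have h4 : (prodBernoulli w).real ((openConn a₃ b)ᶜ : Set (BondConfig (Fin n))) =
      1 - (prodBernoulli w).real (openConn a₃ b : Set (BondConfig (Fin n))) :=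
    probReal_compl_eq_one_sub (hm _)
  linarith

end

end Summit.CriticalPhenomena.PercolationContinuityZ3.Theorems
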